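import Summits.CriticalPhenomena.SAWScalingLimit.Theorems.SAWLoopFugacityFlowIsingBoundaryRatioRadialDefs
import Summits.CriticalPhenomena.SAWScalingLimit.Theorems.SAWLoopFugacityFlowIsingBoundaryRatioHalfAnnulusSideCrossingBoundOf
import HarnessLib

/-!
# Local probabilistic tools for the radial crossing lower bound
(line `fk-anchor-transfer`, crux `IsingBoundaryRatio`, stmt-CriticalPhenomena-10650; helper file of the stub
`stub_halfAnnulusRadialCrossingBound`, RSW clause (iii))

* `rcMeasure_real_biInter_ge_pow` — FKG for finitely many increasing events under a random-cluster measure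
  with `q ≥ 1`: `φ(⋂ A_i) ≥ c ^ #s` if each `φ(A_i) ≥ c ≥ 0` (Grimmett 2006, Thm 3.8, iterated);
* `real_openCrossing_le_local` — FREE MEASURES INCREASE WITH THE DOMAIN, from a lattice block to a local graph
  on a finite volume `Λ ⊆ ℤ²`: if every nearest-neighbour pair of sites of a finite block `S' ⊆ Λ` is an edge
  of a graph `G₀` on `↥Λ`, an open crossing event of `S'` is at most as likely under the free critical
  FK–Ising measure of `S'` as the corresponding event, read on `ℤ²` through `ω ↦ Sym2.map val '' ω`, under the free
  critical FK–Ising measure of `G₀` (Grimmett 2006, Thm 3.1 (a) + Lemma 4.13; the tree's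
  `rcMeasure_real_map_image`, `rcMeasure_fromEdgeSet_real_le`);
* walk surgery: the first vertex of a walk with a property (`exists_walk_firstHit`), and the radial-crossing
  extraction `annCross_of_openWalk` — an open walk from chart radius `≤ ρ₁` to chart radius `≥ ρ₂` contains
  an `AnnCross` (last visit to `≤ ρ₁`, then first visit to `≥ ρ₂`).
[folklore]
-/

noncomputable section

open scoped Classical
open Set SimpleGraph MeasureTheory Finset
open Literature.Probability.LatticeModels Literature.Probability.RandomPlanarGeometry
open Literature.Probability.Percolation (BondConfig openCrossing openGraph openGraph_adj openConnIn)

namespace Summit.CriticalPhenomena.SAWScalingLimit.Theorems.IsingBoundaryRatio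

namespace RadialChain

/-! ### FKG for finitely many increasing events -/

/-- **Iterated FKG**: under a random-cluster measure with `0 ≤ p ≤ 1`, `q ≥ 1`, finitely many increasing
events each of probability `≥ c ≥ 0` occur simultaneously with probability `≥ c ^ #s`.
[cite: Grimmett2006, Thm. (3.8)] -/
theorem rcMeasure_real_biInter_ge_pow {V ι : Type*} [Fintype V] [DecidableEq V] (G : SimpleGraph V)
    [DecidableRel G.Adj] {p q : ℝ} (hp : p ∈ Set.Icc (0 : ℝ) 1) (hq : 1 ≤ q) (B : Set V)
    (s : Finset ι) (A : ι → Set (BondConfig V)) (hA : ∀ i ∈ s, IsUpperSet (A i)) {c : ℝ} (hc : 0 ≤ c)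
    (hAc : ∀ i ∈ s, c ≤ (rcMeasure G p q B).real (A i)) :
    c ^ s.card ≤ (rcMeasure G p q B).real (⋂ i ∈ s, A i) := by
  classical
  haveI := isProbabilityMeasure_rcMeasure G hp (one_pos.trans_le hq) B
  induction s using Finset.induction_on with
  | empty => simp
  | @insert a s ha ih =>
    have hup : IsUpperSet (⋂ i ∈ s, A i) := isUpperSet_iInter₂ fun i hi => hA i (Finset.mem_insert_of_mem hi)
    have h1 := ih (fun i hi => hA i (Finset.mem_insert_of_mem hi)) (fun i hi => hAc i (Finset.mem_insert_of_mem hi))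
    have h2 := hAc a (Finset.mem_insert_self a s)
    have fkg := rcMeasure_fkg_holds G hp hq B (hA a (Finset.mem_insert_self a s)) hup
    rw [Finset.card_insert_of_notMem ha, pow_succ, Finset.set_biInter_insert]
    calc c ^ s.card * c ≤ (rcMeasure G p q B).real (⋂ i ∈ s, A i) * (rcMeasure G p q B).real (A a) :=
          mul_le_mul h1 h2 hc measureReal_nonneg
      _ = (rcMeasure G p q B).real (A a) * (rcMeasure G p q B).real (⋂ i ∈ s, A i) := mul_comm _ _
      _ ≤ (rcMeasure G p q B).real (A a ∩ ⋂ i ∈ s, A i) := fkg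

/-! ### Free measures increase with the domain: from a lattice block to a local graph on `↥Λ` -/

section Local

variable {Λ : Finset (Site 2)}

/-- Value-defined subsets of a block, read on `ℤ²`. [folklore] -/
theorem image_val_image_setOf {S' : Finset (Site 2)} (hS : ∀ x ∈ S', x ∈ Λ) (P : Site 2 → Prop) :
    (Subtype.val : ↥Λ → Site 2) ''
        ((fun x : ↥(S' : Set (Site 2)) => (⟨x.1, hS x.1 x.2⟩ : ↥Λ)) '' {x | P x.1}) = {z | z ∈ S' ∧ P z} := by
  ext z
  simp only [Set.mem_image, Set.mem_setOf_eq]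
  constructor
  · rintro ⟨_, ⟨x, hx, rfl⟩, rfl⟩
    exact ⟨x.2, hx⟩
  · rintro ⟨hz, hP⟩
    exact ⟨⟨z, hS z hz⟩, ⟨⟨z, hz⟩, hP, rfl⟩, rfl⟩

/-- **Free measures increase with the domain, from a lattice block to a local graph.** Let `G₀` be a graph
on `↥Λ` containing, as edges, all nearest-neighbour pairs of sites of the finite block `S' ⊆ Λ`. Then for
value-defined `A = {P}`, `C = {Q}`, the probability under the free critical FK–Ising measure of `S'` of an
open crossing from `A` to `C` is at most the probability, under the free critical FK–Ising measure of `G₀`,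
that the configuration read on `ℤ²` has an open crossing of `S'` from `S' ∩ {P}` to `S' ∩ {Q}`.
[cite: Grimmett2006, Thm. (3.1)(a) and Lemma (4.13)] -/
theorem real_openCrossing_le_local (G₀ : SimpleGraph ↥Λ) [DecidableRel G₀.Adj] (S' : Finset (Site 2))
    (hS : ∀ x ∈ S', x ∈ Λ)
    (hadj : ∀ (x y : Site 2) (hx : x ∈ S') (hy : y ∈ S'), (zdGraph 2).Adj x y →
      G₀.Adj ⟨x, hS x hx⟩ ⟨y, hS y hy⟩)
    (P Q : Site 2 → Prop) :
    (fkIsingFiniteMeasure S' ∅).real (openCrossing Set.univ {x | P x.1} {x | Q x.1}) ≤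
      (rcMeasure G₀ criticalFKIsingParam 2 ∅).real
        {ω | Sym2.map (Subtype.val : ↥Λ → Site 2) '' ω ∈ openCrossing (↑S' : Set (Site 2)) {z | z ∈ S' ∧ P z} {z | z ∈ S' ∧ Q z}} := by
  classical
  have hp := criticalFKIsingParam_mem_Icc
  -- the inclusion of vertex types
  set j : ↥(S' : Set (Site 2)) ↪ ↥Λ :=
    ⟨fun x => ⟨x.1, hS x.1 x.2⟩, fun x y hxy => Subtype.ext (Subtype.mk.inj hxy)⟩ with hj
  set G := finsetGraph (zdGraph 2) S' with hG
  -- the edges of the block, read in `Λ`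
  set U₀ : Finset (Sym2 ↥Λ) := G.edgeFinset.map j.sym2Map with hU₀
  have hU₀amb : U₀ ⊆ G₀.edgeFinset := by
    intro e he
    obtain ⟨e', he', rfl⟩ := Finset.mem_map.1 he
    induction e' using Sym2.ind with
    | h a b =>
      rw [mem_edgeFinset, mem_edgeSet] at he'
      have hab : (zdGraph 2).Adj a.1 b.1 := he'
      rw [Function.Embedding.sym2Map_apply, Sym2.map_mk, mem_edgeFinset, mem_edgeSet]
      exact hadj a.1 b.1 a.2 b.2 hab
  -- the graph of the block read in `Λ`
  set G' : SimpleGraph ↥Λ := fromEdgeSet (↑U₀ : Set (Sym2 ↥Λ)) with hG'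
  have hE' : @edgeFinset _ G' G'.fintypeEdgeSet = G.edgeFinset.map j.sym2Map :=
    @edgeFinset_fromEdgeSet_of_subset _ _ G₀ _ U₀ hU₀amb (fintypeEdgeSet _)
  -- the crossing event read in `Λ`
  set A₁ : Set ↥(S' : Set (Site 2)) := {x | P x.1}
  set C₁ : Set ↥(S' : Set (Site 2)) := {x | Q x.1}
  set A' : Set (BondConfig ↥Λ) := openCrossing (j '' Set.univ) (j '' A₁) (j '' C₁) with hA'
  have hA'up : IsUpperSet A' := Literature.Probability.Percolation.isUpperSet_openCrossing _ _ _
  -- step 1: the block's own measure, read in `Λ`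
  have step1 : (fkIsingFiniteMeasure S' ∅).real (openCrossing Set.univ A₁ C₁) =
      (rcMeasure G' criticalFKIsingParam 2 ∅).real A' := by
    rw [fkIsingFiniteMeasure_eq_finsetGraph]
    have h := rcMeasure_real_map_image (G := G) (G' := G') j hE' hp two_pos ∅
      (A := (openCrossing Set.univ A₁ C₁ : Set (BondConfig ↥(S' : Set (Site 2)))))
      (A' := A') fun ω _ => by
        rw [hA', coe_map_sym2Map]
        exact (Literature.Probability.LatticeModels.map_image_mem_openCrossing_iff j _ _ A₁ C₁).symm
    rw [Set.image_empty] at h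
    rw [h]
  -- step 2: free measures increase with the domain
  have h0 : 0 < (rcMeasure G₀ criticalFKIsingParam 2 ∅).real {ω | ω ∩ (↑U₀ : Set (Sym2 ↥Λ))ᶜ = ∅} :=
    rcMeasure_real_pos_of_empty_mem _ hp criticalFKIsingParam_mem_Ioo.2 two_pos ∅
      (by change (∅ : Set (Sym2 ↥Λ)) ∩ (↑U₀ : Set (Sym2 ↥Λ))ᶜ = ∅; exact Set.empty_inter _)
  have step2 := rcMeasure_fromEdgeSet_real_le G₀ hp one_le_two ∅ U₀ hU₀amb h0 hA'up
  -- step 3: read on `ℤ²`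
  haveI : IsProbabilityMeasure (rcMeasure G₀ criticalFKIsingParam 2 ∅) :=
    isProbabilityMeasure_rcMeasure _ hp two_pos _
  set vP : ↥Λ ↪ Site 2 := Function.Embedding.subtype _ with hvP
  have himS : (vP : ↥Λ → Site 2) '' (j '' Set.univ) = ↑S' := by
    ext z
    simp only [Set.mem_image, Set.mem_univ, true_and, Finset.mem_coe]
    constructor
    · rintro ⟨_, ⟨x, rfl⟩, rfl⟩; exact x.2
    · intro hz; exact ⟨j ⟨z, hz⟩, ⟨⟨z, hz⟩, rfl⟩, rfl⟩
  have himA : (vP : ↥Λ → Site 2) '' (j '' A₁) = {z | z ∈ S' ∧ P z} := image_val_image_setOf hS P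
  have himC : (vP : ↥Λ → Site 2) '' (j '' C₁) = {z | z ∈ S' ∧ Q z} := image_val_image_setOf hS Q
  have step3 : (rcMeasure G₀ criticalFKIsingParam 2 ∅).real {ω | ω ∩ ↑U₀ ∈ A'} ≤
      (rcMeasure G₀ criticalFKIsingParam 2 ∅).real
        {ω | Sym2.map (Subtype.val : ↥Λ → Site 2) '' ω ∈ openCrossing (↑S' : Set (Site 2)) {z | z ∈ S' ∧ P z} {z | z ∈ S' ∧ Q z}} := by
    refine measureReal_mono (fun ω hω => ?_) (measure_ne_top _ _)
    have hω' : ω ∈ A' := hA'up Set.inter_subset_left hω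
    have := (Literature.Probability.LatticeModels.map_image_mem_openCrossing_iff vP ω _ _ _).2 hω'
    rw [himS, himA, himC] at this
    exact this
  exact (le_of_eq step1).trans (step2.trans step3)

end Local

/-! ### Walk surgery -/

section Walks

variable {V : Type*} {G : SimpleGraph V}

/-- **First vertex of a walk with a property**: a walk ending at a vertex with property `Q` has an initial
piece (same start, same or fewer vertices and edges) ending at a vertex with `Q` and containing no other
vertex with `Q`. [folklore] -/
theorem exists_walk_firstHit (Q : V → Prop) :
    ∀ {u v : V} (W : G.Walk u v), Q v → ∃ (b : V) (W' : G.Walk u b), Q b ∧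
      (∀ z ∈ W'.support, z = b ∨ ¬ Q z) ∧ (∀ z ∈ W'.support, z ∈ W.support) ∧
      ∀ e ∈ W'.edges, e ∈ W.edges := by
  intro u v W
  induction W with
  | nil =>
    intro hv
    rename_i u
    exact ⟨u, .nil, hv, fun z hz => Or.inl (by simpa using hz), fun z hz => hz, fun e he => he⟩
  | cons hadj W ih =>
    intro hv
    rename_i u w v'
    by_cases hu : Q u
    · exact ⟨u, .nil, hu, fun z hz => Or.inl (by simpa using hz),
        fun z hz => by rw [Walk.support_nil, List.mem_singleton] at hz; rw [hz]; exact Walk.start_mem_support _,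
        fun e he => by simp at he⟩
    · obtain ⟨b, W', hb, hQ, hs, he⟩ := ih hv
      refine ⟨b, .cons hadj W', hb, fun z hz => ?_, fun z hz => ?_, fun e he' => ?_⟩
      · rw [Walk.support_cons, List.mem_cons] at hz
        rcases hz with rfl | hz
        · exact Or.inr hu
        · exact hQ z hz
      · rw [Walk.support_cons, List.mem_cons] at hz ⊢
        rcases hz with rfl | hz
        · exact Or.inl rfl
        · exact Or.inr (hs z hz)
      · rw [Walk.edges_cons, List.mem_cons] at he' ⊢
        rcases he' with rfl | he'
        · exact Or.inl rfl
        · exact Or.inr (he e he')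

/-- **Last visit, then first visit**: a walk from a vertex with `P` to a vertex with `Q` contains a walk from a
vertex with `P` to a vertex with `Q` whose other vertices satisfy neither `P` nor `Q` (using only edges and
vertices of the original walk). [folklore] -/
theorem exists_walk_between (P Q : V → Prop) {u v : V} (W : G.Walk u v) (hu : P u) (hv : Q v) :
    ∃ (a b : V) (W' : G.Walk a b), P a ∧ Q b ∧
      (∀ z ∈ W'.support, z = a ∨ z = b ∨ (¬ P z ∧ ¬ Q z)) ∧ (∀ z ∈ W'.support, z ∈ W.support) ∧
      ∀ e ∈ W'.edges, e ∈ W.edges := by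
  classical
  -- first visit to `Q`
  obtain ⟨b, W₁, hb, hQ₁, hs₁, he₁⟩ := exists_walk_firstHit Q W hv
  -- last visit to `P` = first visit to `P` of the reversed walk
  obtain ⟨a, W₂, ha, hP₂, hs₂, he₂⟩ := exists_walk_firstHit P W₁.reverse hu
  refine ⟨a, b, W₂.reverse, ha, hb, fun z hz => ?_, fun z hz => ?_, fun e he => ?_⟩
  · rw [Walk.support_reverse, List.mem_reverse] at hz
    have h1 := hP₂ z hz
    have hz₁ : z ∈ W₁.support := by have := hs₂ z hz; rwa [Walk.support_reverse, List.mem_reverse] at this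
    have h2 := hQ₁ z hz₁
    tauto
  · rw [Walk.support_reverse, List.mem_reverse] at hz
    have := hs₂ z hz
    rw [Walk.support_reverse, List.mem_reverse] at this
    exact hs₁ z this
  · rw [Walk.edges_reverse, List.mem_reverse] at he
    have := he₂ e he
    rw [Walk.edges_reverse, List.mem_reverse] at this
    exact he₁ e this

end Walks

/-! ### The radial crossing extracted from an open walk -/

/-- **An open walk from chart radius `≤ ρ₁` to chart radius `≥ ρ₂` contains a radial crossing.** For a graph
`H` on `↥Λ`, a "radius" `r`, levels `ρ₁ < ρ₂` and sets `In`, `Ann` such that along the walk the sites of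
radius `≤ ρ₁` are in `In`, those of radius in `(ρ₁, ρ₂)` are in `Ann`, and those of radius `≥ ρ₂` are
outside `In ∪ Ann`: an `ω`-open walk of `H` from radius `≤ ρ₁` to radius `≥ ρ₂` gives `AnnCross H In Ann ω`
(its piece between the last visit to `≤ ρ₁` and the next visit to `≥ ρ₂`). [folklore] -/
theorem annCross_of_openWalk {Λ : Finset (Site 2)} (H : SimpleGraph ↥Λ) (In Ann : Set ↥Λ)
    (ω : BondConfig ↥Λ) (r : ↥Λ → ℝ) {ρ₁ ρ₂ : ℝ} {u v : ↥Λ} (W : H.Walk u v)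
    (hopen : ∀ e ∈ W.edges, e ∈ ω) (hu : r u ≤ ρ₁) (hv : ρ₂ ≤ r v)
    (hIn : ∀ z ∈ W.support, r z ≤ ρ₁ → z ∈ In)
    (hAnn : ∀ z ∈ W.support, ρ₁ < r z → r z < ρ₂ → z ∈ Ann)
    (hout : ∀ z ∈ W.support, ρ₂ ≤ r z → z ∉ In ∪ Ann) :
    AnnCross H In Ann ω := by
  obtain ⟨a, b, W', ha, hb, hmid, hs, he⟩ :=
    exists_walk_between (fun z => r z ≤ ρ₁) (fun z => ρ₂ ≤ r z) W hu hv
  refine ⟨a, b, W', hIn a (hs a W'.start_mem_support) ha, hout b (hs b W'.end_mem_support) hb,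
    fun z hz => ?_, fun e he' => hopen e (he e he')⟩
  rcases hmid z hz with h | h | ⟨h1, h2⟩
  · exact Or.inl h
  · exact Or.inr (Or.inl h)
  · exact Or.inr (Or.inr (hAnn z (hs z hz) (lt_of_not_ge h1) (lt_of_not_ge h2)))

/-- **From an open crossing read in the volume to an open walk of `H`.** If `ω ⊆ E(H)` and `ω` has an open
crossing inside `R` from `A` to `B` (sets of sites of `↥Λ`), there is an `ω`-open walk of `H` inside `R` from
a site of `A` to a site of `B`. [folklore] -/
theorem exists_openWalk_of_openCrossing {Λ : Finset (Site 2)} (H : SimpleGraph ↥Λ) {ω : BondConfig ↥Λ}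
    (hω : ∀ e ∈ ω, e ∈ H.edgeSet) {R A B : Set ↥Λ} (h : ω ∈ openCrossing R A B) :
    ∃ (a b : ↥Λ) (W : H.Walk a b), a ∈ A ∧ b ∈ B ∧ (∀ z ∈ W.support, z ∈ R) ∧ ∀ e ∈ W.edges, e ∈ ω := by
  obtain ⟨x, hx, y, hy, hxR, hyR, hr⟩ := h
  obtain ⟨q⟩ := hr
  obtain ⟨p, hs, he⟩ := exists_walk_of_walk_induce_openGraph H hω R _ _ q
  exact ⟨x, y, p, hx, hy, hs, he⟩

end RadialChain

/-- **An open walk from chart radius `≤ ρ₁` to chart radius `≥ ρ₂` contains a radial crossing** (registered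
sub-goal of stmt-CriticalPhenomena-10650, clause (iii) helper; closed form of `RadialChain.annCross_of_openWalk`).
[folklore] -/
theorem radial_annCross_of_openWalk : ∀ {Λ : Finset (Site 2)} (H : SimpleGraph ↥Λ) (In Ann : Set ↥Λ) (ω : BondConfig ↥Λ) (r : ↥Λ → ℝ) {ρ₁ ρ₂ : ℝ} {u v : ↥Λ} (W : H.Walk u v), (∀ e ∈ W.edges, e ∈ ω) → r u ≤ ρ₁ → ρ₂ ≤ r v → (∀ z ∈ W.support, r z ≤ ρ₁ → z ∈ In) → (∀ z ∈ W.support, ρ₁ < r z → r z < ρ₂ → z ∈ Ann) → (∀ z ∈ W.support, ρ₂ ≤ r z → z ∉ In ∪ Ann) → AnnCross H In Ann ω :=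
  fun H In Ann ω r _ _ _ _ W h1 h2 h3 h4 h5 h6 => RadialChain.annCross_of_openWalk H In Ann ω r W h1 h2 h3 h4 h5 h6

end Summit.CriticalPhenomena.SAWScalingLimit.Theorems.IsingBoundaryRatio

end
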